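import Summits.RiemannHypothesis.RiemannHypothesis.Theorems.RuelleBandExactFirstBandStubOddSectorCriterion
import Literature.NumberTheory.LFunctions.WeilZeroSum
import Literature.NumberTheory.LFunctions.WeilMellinBounds
import HarnessLib

/-!
# Crux `OffLineParityDetection` (stmt-RiemannHypothesis-15431), line `registered`: stub **ODD-ON**

Route `WeilParity`, crux `Summit.RiemannHypothesis.RiemannHypothesis.Theses.WeilParity.OffLineParityDetection`,
line `registered`.  This file proves the registered stub `stub_oddOnLineUpperBound` BY NAME, with the
registered signature: for a REAL-valued ODD Weil test `o` and the (assumed finite) set `S` of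
off-line zeros of `ζ` in the open critical strip,

  `Re Q(o) ≤ (‖o‖₁ + ‖o″‖₁)² · Σ_ρ m(ρ)/(1 + γ²)² - Σ_{ρ ∈ S} m(ρ) Re ô(ρ)²`.

## Proof

* Zero-side form: `Q(o) = Q₀(o) = Σ_ρ m(ρ) P_o(ρ)` over the non-trivial zeros
  (`WeilConverse.zeroForm`; both sides are the limit of the symmetric partial zero sums of
  `o ⋆ õ`, `WeilConverse.hasWeilZeroSide_zeroForm` and the PROVED explicit formula
  `explicit_formula_holds`), absolutely convergent (`WeilConverse.summable_pairCoeff`), so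
  `Re Q(o) = Σ_ρ Re (m(ρ) P_o(ρ))` (`Complex.re_tsum`).
* For a real odd `o`, `P_o(ρ) = -ô(ρ)²` (`RuelleBandExactFirstBand.pairCoeff_of_odd_real`), so the
  summand at `ρ` is `-m(ρ) Re ô(ρ)²`, and `|P_o(ρ)| = |ô(ρ)|²`.
* LINE BOUND (`norm_weilMellin_le_of_re_eq_half`): on the critical line `Re s = 1/2` the kernel
  `e^{(s - 1/2)t}` is unimodular, so `|ĝ(s)| ≤ ‖g‖₁` for every `g`; with `(g″)^(s) = (s - 1/2)² ĝ(s)`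
  (`weilMellin_deriv_deriv`) and `|s - 1/2|² ≥ (Im s)²` this gives
  `|ĝ(s)| ≤ (‖g‖₁ + ‖g″‖₁)/(1 + (Im s)²)`.
* Every non-trivial zero outside `S` lies on the critical line (`S` is ALL the off-line zeros of the
  open strip, `ZetaZeros.riemannZetaNontrivialZeros.mem_iff'`), so there
  `Re (m(ρ) P_o(ρ)) ≤ m(ρ) |ô(ρ)|² ≤ L² · m(ρ)/(1 + γ²)² = L² · weilZeroWeight ρ`, `L = ‖o‖₁ + ‖o″‖₁`.
* Bookkeeping: split the absolutely convergent sum into the finite part over `S` (kept exactly) and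
  the tail (`Summable.sum_add_tsum_compl`), bound the tail termwise (`Summable.tsum_le_tsum`) and
  then by the full non-negative sum `L² Σ_ρ weilZeroWeight ρ` (`Summable.tsum_subtype_le`,
  `weilZeroWeight_nonneg`, `weilZeroSummable`, `tsum_mul_left`).

References: E. Bombieri, *Remarks on Weil's quadratic functional in the theory of prime numbers I*,
Rend. Lincei (9) 11 (2000), 183–233, §3 (zero-side form of `W(f ⋆ f̄*)`); A. Weil, *Sur les
"formules explicites" de la théorie des nombres premiers* (1952).
-/

-- the problem directory `RiemannHypothesis/RiemannHypothesis` fixes the namespace (gate convention)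
set_option linter.dupNamespace false

noncomputable section

namespace Summit.RiemannHypothesis.RiemannHypothesis.Theorems.WeilParityOffLineParityDetection

open MeasureTheory Set Filter
open scoped ComplexConjugate Topology
open Literature.NumberTheory.LFunctions
open Summit.RiemannHypothesis.RiemannHypothesis.Theorems.RuelleBandExactFirstBand
  (pairCoeff_of_odd_real)

/-! ### The line bound -/

/-- On the critical line the Weil kernel is unimodular: `|ĝ(s)| ≤ ∫ |g|` for `Re s = 1/2` and ANY
`g : ℝ → ℂ` (`‖e^{(s-1/2)t}‖ = e^{Re((s-1/2)t)} = 1`, `norm_integral_le_integral_norm`; if the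
integrand is not integrable both sides are compatible junk, the right side being `≥ 0`). [folklore] -/
theorem norm_weilMellin_le_integral_norm (g : ℝ → ℂ) {s : ℂ} (hs : s.re = 1 / 2) :
    ‖weilMellin g s‖ ≤ ∫ t : ℝ, ‖g t‖ := by
  unfold weilMellin
  refine (norm_integral_le_integral_norm _).trans_eq (integral_congr_ae
    (Eventually.of_forall fun t ↦ ?_))
  have hre : ((s - 1 / 2) * (t : ℂ)).re = (s.re - 1 / 2) * t := by
    simp [Complex.sub_re, Complex.mul_re]
  simp only [norm_mul, Complex.norm_exp, hre, hs, sub_self, zero_mul, Real.exp_zero, mul_one]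

/-- **Line bound** (two integrations by parts, no exponential weight): for a Weil test `g` and
`Re s = 1/2`, `|ĝ(s)| ≤ (∫|g| + ∫|g″|)/(1 + (Im s)²)`.  Indeed `|ĝ(s)| ≤ ∫|g|` and
`|(s - 1/2)² ĝ(s)| = |(g″)^(s)| ≤ ∫|g″|` (`norm_weilMellin_le_integral_norm`,
`weilMellin_deriv_deriv`), and `(Im s)² ≤ |s - 1/2|²`. [folklore] -/
theorem norm_weilMellin_le_of_re_eq_half {g : ℝ → ℂ} (hg : IsWeilTest g) {s : ℂ}
    (hs : s.re = 1 / 2) :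
    ‖weilMellin g s‖ ≤ ((∫ t : ℝ, ‖g t‖) + ∫ t : ℝ, ‖deriv (deriv g) t‖) / (1 + s.im ^ 2) := by
  -- adapted from `norm_weilMellin_le` (Literature/NumberTheory/LFunctions/WeilMellinBounds.lean)
  have hpos : 0 < 1 + s.im ^ 2 := by positivity
  rw [le_div_iff₀ hpos]
  have h1 : ‖weilMellin g s‖ ≤ ∫ t : ℝ, ‖g t‖ := norm_weilMellin_le_integral_norm g hs
  have h2 : ‖weilMellin (deriv (deriv g)) s‖ ≤ ∫ t : ℝ, ‖deriv (deriv g) t‖ :=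
    norm_weilMellin_le_integral_norm _ hs
  rw [weilMellin_deriv_deriv hg, norm_mul, norm_pow] at h2
  have h3 : s.im ^ 2 ≤ ‖s - 1 / 2‖ ^ 2 := by
    have : |s.im| ≤ ‖s - 1 / 2‖ := by
      have h := Complex.abs_im_le_norm (s - 1 / 2)
      simpa using h
    nlinarith [abs_nonneg s.im, sq_abs s.im]
  have h4 : 0 ≤ ‖weilMellin g s‖ := norm_nonneg _
  nlinarith

/-! ### The summand of the zero-side form for a real odd test -/

/-- For a real odd test `o` the summand of `Re Q₀(o)` at `ρ` is `-m(ρ) Re ô(ρ)²`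
(`P_o(ρ) = -ô(ρ)²`, `pairCoeff_of_odd_real`; `m(ρ)` is an integer). [folklore] -/
theorem re_order_mul_pairCoeff_of_odd_real {o : ℝ → ℂ} (hodd : ∀ t : ℝ, o (-t) = -o t)
    (hreal : ∀ t : ℝ, (o t).im = 0) (ρ : ℂ) :
    ((riemannZetaZeroOrder ρ : ℂ) * WeilConverse.pairCoeff o ρ).re =
      -((riemannZetaZeroOrder ρ : ℝ) * ((weilMellin o ρ) ^ 2).re) := by
  rw [pairCoeff_of_odd_real hodd hreal, ← Complex.ofReal_intCast, Complex.re_ofReal_mul,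
    Complex.neg_re, pow_two, mul_neg]

/-- **Termwise bound on the critical line.** For a real odd Weil test `o` and a non-trivial zero
`ρ` with `Re ρ = 1/2`: `Re (m(ρ) P_o(ρ)) ≤ L² · weilZeroWeight ρ`, `L = ∫|o| + ∫|o″|`
(`|P_o(ρ)| = |ô(ρ)|²`, the line bound, `m(ρ) ≥ 0`). [folklore] -/
theorem re_order_mul_pairCoeff_le_of_re_eq_half {o : ℝ → ℂ} (ho : IsWeilTest o)
    (hodd : ∀ t : ℝ, o (-t) = -o t) (hreal : ∀ t : ℝ, (o t).im = 0) {ρ : ℂ}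
    (hρ : ρ ∈ ZetaZeros.riemannZetaNontrivialZeros) (hline : ρ.re = 1 / 2) :
    ((riemannZetaZeroOrder ρ : ℂ) * WeilConverse.pairCoeff o ρ).re ≤
      ((∫ t : ℝ, ‖o t‖) + ∫ t : ℝ, ‖deriv (deriv o) t‖) ^ 2 * weilZeroWeight ρ := by
  set L : ℝ := (∫ t : ℝ, ‖o t‖) + ∫ t : ℝ, ‖deriv (deriv o) t‖ with hL
  have hm : (0 : ℝ) ≤ riemannZetaZeroOrder ρ := by
    exact_mod_cast riemannZetaZeroOrder_nonneg (ZetaZeros.riemannZetaNontrivialZeros.ne_one hρ)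
  have hb : ‖weilMellin o ρ‖ ≤ L / (1 + ρ.im ^ 2) := norm_weilMellin_le_of_re_eq_half ho hline
  calc ((riemannZetaZeroOrder ρ : ℂ) * WeilConverse.pairCoeff o ρ).re
      ≤ ‖(riemannZetaZeroOrder ρ : ℂ) * WeilConverse.pairCoeff o ρ‖ := Complex.re_le_norm _
    _ = (riemannZetaZeroOrder ρ : ℝ) * ‖weilMellin o ρ‖ ^ 2 := by
        rw [norm_mul, Complex.norm_intCast, abs_of_nonneg hm, pairCoeff_of_odd_real hodd hreal,
          norm_neg, norm_mul, ← pow_two]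
    _ ≤ (riemannZetaZeroOrder ρ : ℝ) * (L / (1 + ρ.im ^ 2)) ^ 2 :=
        mul_le_mul_of_nonneg_left (pow_le_pow_left₀ (norm_nonneg _) hb 2) hm
    _ = L ^ 2 * weilZeroWeight ρ := by
        rw [weilZeroWeight, div_pow]
        ring

/-! ### The registered stub -/

/-- **Stub `stub_oddOnLineUpperBound` (ODD-ON) of line `registered` — registered signature.**  For a
REAL-valued ODD Weil test `o` and the finite set `S` of off-line zeros of `ζ` in the open strip,
`Re Q(o) ≤ (‖o‖₁ + ‖o″‖₁)² · Σ_ρ m(ρ)/(1+γ²)² - Σ_{ρ ∈ S} m(ρ) Re ô(ρ)²`.  Proof: zero-side form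
`Re Q(o) = Σ_ρ Re (m(ρ) P_o(ρ))` (`WeilConverse.hasWeilZeroSide_zeroForm`, `explicit_formula_holds`,
`Complex.re_tsum`); the terms at `ρ ∈ S` are `-m(ρ) Re ô(ρ)²` (`re_order_mul_pairCoeff_of_odd_real`)
and are kept; every other non-trivial zero is on the critical line and contributes at most
`L² · weilZeroWeight ρ` (`re_order_mul_pairCoeff_le_of_re_eq_half`); the weights are non-negative and
summable (`weilZeroWeight_nonneg`, `weilZeroSummable`), so the tail is at most `L² Σ_ρ weilZeroWeight ρ`.
[folklore] -/
theorem stub_oddOnLineUpperBound :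
    ∀ o : ℝ → ℂ, IsWeilTest o → (∀ t, o (-t) = -o t) → (∀ t, (o t).im = 0) →
      ∀ hS : ({ρ : ℂ | riemannZeta ρ = 0 ∧ 0 < ρ.re ∧ ρ.re < 1 ∧ ρ.re ≠ 1 / 2}).Finite,
        (weilQuadratic o).re ≤
          ((∫ t, ‖o t‖) + ∫ t, ‖deriv (deriv o) t‖) ^ 2 *
              (∑' ρ : ZetaZeros.riemannZetaNontrivialZeros, weilZeroWeight (ρ : ℂ)) -
            ∑ ρ ∈ hS.toFinset, (riemannZetaZeroOrder ρ : ℝ) * ((weilMellin o ρ) ^ 2).re := by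
  intro o ho hodd hreal hS
  classical
  set L : ℝ := (∫ t, ‖o t‖) + ∫ t, ‖deriv (deriv o) t‖ with hL
  -- `Q₀(o) = Q(o)`: both are the limit of the symmetric partial zero sums of `o ⋆ õ`
  have hQW : WeilConverse.zeroForm o = weilQuadratic o :=
    tendsto_nhds_unique (WeilConverse.hasWeilZeroSide_zeroForm ho)
      (explicit_formula_holds (ho.weilConv ho.weilReflect))
  rw [← hQW, WeilConverse.zeroForm, Complex.re_tsum (WeilConverse.summable_pairCoeff ho)]
  -- the real summand family
  set f : ZetaZeros.riemannZetaNontrivialZeros → ℝ := fun ρ ↦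
    ((riemannZetaZeroOrder (ρ : ℂ) : ℂ) * WeilConverse.pairCoeff o ρ).re with hf
  have hfs : Summable f := (Complex.hasSum_re (WeilConverse.summable_pairCoeff ho).hasSum).summable
  -- `S ⊆` non-trivial zeros; transport `hS.toFinset` to a finset of non-trivial zeros
  have hSZ : ∀ ρ ∈ hS.toFinset, ρ ∈ ZetaZeros.riemannZetaNontrivialZeros := fun ρ hρ ↦ by
    obtain ⟨hζ, h0, -, -⟩ := (Set.Finite.mem_toFinset hS).1 hρ
    exact ZetaZeros.riemannZetaNontrivialZeros.mem_of_re_pos hζ h0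
  set F : Finset ZetaZeros.riemannZetaNontrivialZeros :=
    hS.toFinset.subtype (· ∈ ZetaZeros.riemannZetaNontrivialZeros) with hF
  have hsumF : ∑ ρ ∈ hS.toFinset, (riemannZetaZeroOrder ρ : ℝ) * ((weilMellin o ρ) ^ 2).re =
      ∑ x ∈ F, (riemannZetaZeroOrder (x : ℂ) : ℝ) * ((weilMellin o x) ^ 2).re := by
    rw [hF, Finset.sum_subtype_of_mem
      (fun ρ : ℂ ↦ (riemannZetaZeroOrder ρ : ℝ) * ((weilMellin o ρ) ^ 2).re) hSZ]
  -- off `F` every non-trivial zero is on the critical line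
  have hline : ∀ x : ZetaZeros.riemannZetaNontrivialZeros, x ∉ F → (x : ℂ).re = 1 / 2 := by
    intro x hx
    by_contra hne
    apply hx
    rw [hF, Finset.mem_subtype, Set.Finite.mem_toFinset]
    exact ⟨ZetaZeros.riemannZetaNontrivialZeros.zeta_eq_zero x.2,
      ZetaZeros.riemannZetaNontrivialZeros.re_pos x.2,
      ZetaZeros.riemannZetaNontrivialZeros.re_lt_one x.2, hne⟩
  -- the finite part over `S` is kept exactly
  have h1 : ∑ x ∈ F, f x =
      -∑ ρ ∈ hS.toFinset, (riemannZetaZeroOrder ρ : ℝ) * ((weilMellin o ρ) ^ 2).re := by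
    rw [hsumF, ← Finset.sum_neg_distrib]
    exact Finset.sum_congr rfl fun x _ ↦ re_order_mul_pairCoeff_of_odd_real hodd hreal (x : ℂ)
  -- the tail is on the line and is bounded by the full weight sum
  have hws : Summable fun ρ : ZetaZeros.riemannZetaNontrivialZeros ↦ L ^ 2 * weilZeroWeight (ρ : ℂ) :=
    weilZeroSummable.mul_left _
  have hw0 : ∀ ρ : ZetaZeros.riemannZetaNontrivialZeros, 0 ≤ L ^ 2 * weilZeroWeight (ρ : ℂ) :=
    fun ρ ↦ mul_nonneg (sq_nonneg _) (weilZeroWeight_nonneg ρ.2)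
  have h2 : ∑' x : ((F : Set ZetaZeros.riemannZetaNontrivialZeros)ᶜ : Set _), f x ≤
      L ^ 2 * ∑' ρ : ZetaZeros.riemannZetaNontrivialZeros, weilZeroWeight (ρ : ℂ) := by
    calc ∑' x : ((F : Set ZetaZeros.riemannZetaNontrivialZeros)ᶜ : Set _), f x
        ≤ ∑' x : ((F : Set ZetaZeros.riemannZetaNontrivialZeros)ᶜ : Set _),
            L ^ 2 * weilZeroWeight ((x : ZetaZeros.riemannZetaNontrivialZeros) : ℂ) := by
          refine Summable.tsum_le_tsum (fun x ↦ ?_) (hfs.subtype _) (hws.subtype _)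
          have hx : (x : ZetaZeros.riemannZetaNontrivialZeros) ∉ F := by
            have h := x.2
            rwa [Set.mem_compl_iff, Finset.mem_coe] at h
          exact re_order_mul_pairCoeff_le_of_re_eq_half ho hodd hreal
            (x : ZetaZeros.riemannZetaNontrivialZeros).2 (hline _ hx)
      _ ≤ ∑' ρ : ZetaZeros.riemannZetaNontrivialZeros, L ^ 2 * weilZeroWeight (ρ : ℂ) :=
          hws.tsum_subtype_le _ _ hw0
      _ = L ^ 2 * ∑' ρ : ZetaZeros.riemannZetaNontrivialZeros, weilZeroWeight (ρ : ℂ) :=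
          tsum_mul_left
  rw [← hfs.sum_add_tsum_compl (s := F), h1]
  linarith

end Summit.RiemannHypothesis.RiemannHypothesis.Theorems.WeilParityOffLineParityDetection

end
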